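import Mathlib
import Summits.MatrixMultiplication.MatrixMultiplication.Theses.FidelityWitnesses
import Summits.MatrixMultiplication.MatrixMultiplication.Theorems.FidelityWitnessesRankTwoAdditivityNorms
import Summits.MatrixMultiplication.MatrixMultiplication.Theorems.FidelityWitnessesRankTwoAdditivityReduction
import Summits.MatrixMultiplication.MatrixMultiplication.Theorems.FidelityWitnessesRankTwoAdditivityDuality
import Summits.MatrixMultiplication.MatrixMultiplication.Theorems.FidelityWitnessesRankTwoAdditivityCases
import Summits.MatrixMultiplication.MatrixMultiplication.Theorems.FidelityWitnessesRankTwoAdditivityLmiUnit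

/-!
# `FidelityWitnesses.RankTwoAdditivity` (stmt-MatrixMultiplication-4964) — proof of the route statement

`lmi_exists` (the certificate hypotheses of `core_of_certificate` in the strict case, by rescaling `lmi_unit`),
the core four-matrix inequality `core_ineq` (zero / collinear cases from the Cases file, strict case from the
2×2 certificate and weak duality), and the route statement `RankTwoAdditivity` (`M(n,2) = 2`: a bilinear form of
tensor rank ≤ 2 has flattening-fidelity witness value ≤ 2‖S‖²) via `rankTwoAdditivity_of_core`.
Mathematically: frames → unital CP maps → one-sided weak duality → certificate `ζ_p = (1−p)1 + p·Tr_AΠ` →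
pencil lemma + key lemma (maximally entangled / balanced cases; the balanced case is the 2×2 fidelity chain
`|c| ≤ κF(D, YD₁Y*) ≤ κF(D, 1−D_Y) = κF(1−D, D_Y) ≤ √(tr((1−D)P) tr(D_Y κ²P⁻¹))`).
Closes item `stmt-MatrixMultiplication-4964`; no definitions are introduced.
-/

namespace Summit.MatrixMultiplication.MatrixMultiplication.Theorems.RankTwoAdditivity

open scoped BigOperators ComplexConjugate

/-- Rescaling a vector by a positive real: norms and inner products. -/
theorem rescale_facts {ι : Type*} [Fintype ι] (v : ι → ℂ) (t : ℝ) (ht : 0 < t)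
    (hv : (∑ i, ‖v i‖ ^ 2) = t ^ 2) :
    (∑ i, ‖(t : ℂ)⁻¹ * v i‖ ^ 2) = 1 := by
  have : (∑ i, ‖(t : ℂ)⁻¹ * v i‖ ^ 2) = t⁻¹ ^ 2 * ∑ i, ‖v i‖ ^ 2 := by
    rw [Finset.mul_sum]; exact Finset.sum_congr rfl fun i _ => by
      rw [norm_mul, norm_inv, Complex.norm_real, Real.norm_of_nonneg ht.le, mul_pow]
  rw [this, hv, inv_pow, inv_mul_cancel₀ (pow_ne_zero 2 ht.ne')]

/-- **Existence of the 2×2 certificate** in the strict (non-collinear) case: the hypotheses `htr`, `hLMI` of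
`core_of_certificate`, obtained from `lmi_unit` by normalising `Y₁, Y₂, x` and rescaling. -/
theorem lmi_exists {ι κ μ : Type*} [Fintype ι] [Fintype κ] [Fintype μ]
    (u₁ u₂ : ι × κ → ℂ) (v₁ v₂ : κ × μ → ℂ)
    (hx : ‖∑ b, conj (u₁ b) * u₂ b‖ ^ 2 < (∑ b, ‖u₁ b‖ ^ 2) * ∑ b, ‖u₂ b‖ ^ 2)
    (hy : ‖∑ c, conj (v₁ c) * v₂ c‖ ^ 2 < (∑ c, ‖v₁ c‖ ^ 2) * ∑ c, ‖v₂ c‖ ^ 2) :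
    ∃ z₁₁ z₂₂ : ℝ, ∃ z₂₁ : ℂ,
      (z₁₁ * (∑ b, ‖u₁ b‖ ^ 2) + z₂₂ * (∑ b, ‖u₂ b‖ ^ 2)
          + 2 * (z₂₁ * ∑ b, conj (u₁ b) * u₂ b).re
        ≤ 2 * ((∑ b, ‖u₁ b‖ ^ 2) * ∑ c, ‖v₁ c‖ ^ 2) * ((∑ b, ‖u₂ b‖ ^ 2) * ∑ c, ‖v₂ c‖ ^ 2)
          - 2 * ‖(∑ b, conj (u₁ b) * u₂ b) * ∑ c, conj (v₁ c) * v₂ c‖ ^ 2) ∧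
      ∀ ψ₁ ψ₂ : κ → ℂ,
        ((∑ b, ‖u₂ b‖ ^ 2) * ∑ c, ‖v₂ c‖ ^ 2) * (∑ c, ‖∑ m, conj (v₁ (m, c)) * ψ₁ m‖ ^ 2)
          + ((∑ b, ‖u₁ b‖ ^ 2) * ∑ c, ‖v₁ c‖ ^ 2) * (∑ c, ‖∑ m, conj (v₂ (m, c)) * ψ₂ m‖ ^ 2)
          - 2 * (conj ((∑ b, conj (u₁ b) * u₂ b) * ∑ c, conj (v₁ c) * v₂ c)
              * ∑ c, conj (∑ m, conj (v₂ (m, c)) * ψ₂ m) * ∑ m, conj (v₁ (m, c)) * ψ₁ m).re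
        ≤ z₁₁ * (∑ m, ‖ψ₁ m‖ ^ 2) + z₂₂ * (∑ m, ‖ψ₂ m‖ ^ 2)
          + 2 * (z₂₁ * ∑ m, conj (ψ₂ m) * ψ₁ m).re := by
  -- names
  set nu₁ : ℝ := ∑ b, ‖u₁ b‖ ^ 2 with hnu₁
  set nu₂ : ℝ := ∑ b, ‖u₂ b‖ ^ 2 with hnu₂
  set nv₁ : ℝ := ∑ c, ‖v₁ c‖ ^ 2 with hnv₁
  set nv₂ : ℝ := ∑ c, ‖v₂ c‖ ^ 2 with hnv₂
  set x : ℂ := ∑ b, conj (u₁ b) * u₂ b with hxdef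
  set y : ℂ := ∑ c, conj (v₁ c) * v₂ c with hydef
  -- positivity of the norms
  have hnu₁0 : 0 ≤ nu₁ := Finset.sum_nonneg fun _ _ => by positivity
  have hnu₂0 : 0 ≤ nu₂ := Finset.sum_nonneg fun _ _ => by positivity
  have hnv₁0 : 0 ≤ nv₁ := Finset.sum_nonneg fun _ _ => by positivity
  have hnv₂0 : 0 ≤ nv₂ := Finset.sum_nonneg fun _ _ => by positivity
  have hxu : 0 < nu₁ * nu₂ := lt_of_le_of_lt (by positivity) hx
  have hyv : 0 < nv₁ * nv₂ := lt_of_le_of_lt (by positivity) hy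
  have hnu₁ : 0 < nu₁ := by
    rcases hnu₁0.lt_or_eq with h | h
    · exact h
    · rw [← h, zero_mul] at hxu; exact absurd hxu (lt_irrefl 0)
  have hnu₂ : 0 < nu₂ := by
    rcases hnu₂0.lt_or_eq with h | h
    · exact h
    · rw [← h, mul_zero] at hxu; exact absurd hxu (lt_irrefl 0)
  have hnv₁ : 0 < nv₁ := by
    rcases hnv₁0.lt_or_eq with h | h
    · exact h
    · rw [← h, zero_mul] at hyv; exact absurd hyv (lt_irrefl 0)
  have hnv₂ : 0 < nv₂ := by
    rcases hnv₂0.lt_or_eq with h | h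
    · exact h
    · rw [← h, mul_zero] at hyv; exact absurd hyv (lt_irrefl 0)
  set s₁ : ℝ := Real.sqrt nu₁ with hs₁
  set s₂ : ℝ := Real.sqrt nu₂ with hs₂
  set t₁ : ℝ := Real.sqrt nv₁ with ht₁
  set t₂ : ℝ := Real.sqrt nv₂ with ht₂
  have hs₁p : 0 < s₁ := Real.sqrt_pos.2 hnu₁
  have hs₂p : 0 < s₂ := Real.sqrt_pos.2 hnu₂
  have ht₁p : 0 < t₁ := Real.sqrt_pos.2 hnv₁
  have ht₂p : 0 < t₂ := Real.sqrt_pos.2 hnv₂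
  have hs₁2 : s₁ ^ 2 = nu₁ := Real.sq_sqrt hnu₁0
  have hs₂2 : s₂ ^ 2 = nu₂ := Real.sq_sqrt hnu₂0
  have ht₁2 : t₁ ^ 2 = nv₁ := Real.sq_sqrt hnv₁0
  have ht₂2 : t₂ ^ 2 = nv₂ := Real.sq_sqrt hnv₂0
  -- normalised Y's
  set w₁ : κ × μ → ℂ := fun c => (t₁ : ℂ)⁻¹ * v₁ c with hw₁
  set w₂ : κ × μ → ℂ := fun c => (t₂ : ℂ)⁻¹ * v₂ c with hw₂
  have hw₁n : (∑ c, ‖w₁ c‖ ^ 2) = 1 := rescale_facts v₁ t₁ ht₁p ht₁2.symm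
  have hw₂n : (∑ c, ‖w₂ c‖ ^ 2) = 1 := rescale_facts v₂ t₂ ht₂p ht₂2.symm
  have hyw : (∑ c, conj (w₁ c) * w₂ c) = ((t₁ * t₂ : ℝ) : ℂ)⁻¹ * y := by
    rw [hydef, Finset.mul_sum]
    refine Finset.sum_congr rfl fun c _ => ?_
    simp only [hw₁, hw₂, map_mul, map_inv₀, Complex.conj_ofReal]
    push_cast
    field_simp
  set yh : ℂ := ((t₁ * t₂ : ℝ) : ℂ)⁻¹ * y with hyh
  set xh : ℂ := ((s₁ * s₂ : ℝ) : ℂ)⁻¹ * x with hxh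
  have ht12p : 0 < t₁ * t₂ := mul_pos ht₁p ht₂p
  have hs12p : 0 < s₁ * s₂ := mul_pos hs₁p hs₂p
  have hyhn : ‖yh‖ < 1 := by
    rw [hyh, norm_mul, norm_inv, Complex.norm_real, Real.norm_of_nonneg ht12p.le,
      inv_mul_lt_iff₀ ht12p, mul_one]
    exact lt_of_pow_lt_pow_left₀ 2 ht12p.le (by rw [mul_pow, ht₁2, ht₂2]; exact hy)
  have hxhn : ‖xh‖ < 1 := by
    rw [hxh, norm_mul, norm_inv, Complex.norm_real, Real.norm_of_nonneg hs12p.le,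
      inv_mul_lt_iff₀ hs12p, mul_one]
    exact lt_of_pow_lt_pow_left₀ 2 hs12p.le (by rw [mul_pow, hs₁2, hs₂2]; exact hx)
  have hyw' : ‖∑ c, conj (w₁ c) * w₂ c‖ < 1 := by rw [hyw]; exact hyhn
  obtain ⟨p', hU⟩ := lmi_unit w₁ w₂ hw₁n hw₂n hyw' xh hxhn
  rw [hyw] at hU
  -- the certificate
  set K₁ : ℝ := (1 - p') * (1 - ‖xh * yh‖ ^ 2) / (1 - ‖xh‖ ^ 2) with hK₁
  set D : ℝ := K₁ + p' with hD
  set K₂ : ℝ := K₁ + p' * ‖yh‖ ^ 2 with hK₂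
  -- basic rescaling identities
  have hs12 : ((s₁ * s₂ : ℝ) : ℂ) ≠ 0 := by exact_mod_cast hs12p.ne'
  have ht12 : ((t₁ * t₂ : ℝ) : ℂ) ≠ 0 := by exact_mod_cast ht12p.ne'
  have hx_eq : x = ((s₁ * s₂ : ℝ) : ℂ) * xh := by rw [hxh, ← mul_assoc, mul_inv_cancel₀ hs12, one_mul]
  have hy_eq : y = ((t₁ * t₂ : ℝ) : ℂ) * yh := by rw [hyh, ← mul_assoc, mul_inv_cancel₀ ht12, one_mul]
  have hconjxh : conj xh * xh = ((‖xh‖ ^ 2 : ℝ) : ℂ) := by rw [Complex.conj_mul', Complex.ofReal_pow]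
  have hxy2 : ‖x * y‖ ^ 2 = (s₁ * s₂) ^ 2 * (t₁ * t₂) ^ 2 * ‖xh * yh‖ ^ 2 := by
    rw [hx_eq, hy_eq, show ((s₁ * s₂ : ℝ) : ℂ) * xh * (((t₁ * t₂ : ℝ) : ℂ) * yh)
      = (((s₁ * s₂) * (t₁ * t₂) : ℝ) : ℂ) * (xh * yh) by push_cast; ring, norm_mul, Complex.norm_real,
      Real.norm_of_nonneg (mul_pos hs12p ht12p).le, mul_pow, mul_pow]
  have hX1 : ‖xh‖ ^ 2 < 1 := pow_lt_one₀ (norm_nonneg xh) hxhn two_ne_zero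
  have hXY : ‖xh * yh‖ ^ 2 = ‖xh‖ ^ 2 * ‖yh‖ ^ 2 := by rw [norm_mul, mul_pow]
  refine ⟨(t₁ * t₂) ^ 2 * s₂ ^ 2 * D, (t₁ * t₂) ^ 2 * s₁ ^ 2 * D,
    (((t₁ * t₂) ^ 2 * (s₁ * s₂) : ℝ) : ℂ) * (-(conj xh * (K₂ : ℂ))), ?_, ?_⟩
  · -- the trace bound (an equality)
    apply le_of_eq
    have ere : ((((t₁ * t₂) ^ 2 * (s₁ * s₂) : ℝ) : ℂ) * (-(conj xh * (K₂ : ℂ))) * x).re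
        = -((t₁ * t₂) ^ 2 * (s₁ * s₂) ^ 2 * K₂ * ‖xh‖ ^ 2) := by
      rw [hx_eq, show (((t₁ * t₂) ^ 2 * (s₁ * s₂) : ℝ) : ℂ) * (-(conj xh * (K₂ : ℂ))) * (((s₁ * s₂ : ℝ) : ℂ) * xh)
        = ((-((t₁ * t₂) ^ 2 * (s₁ * s₂) ^ 2 * K₂) : ℝ) : ℂ) * (conj xh * xh) by push_cast; ring, hconjxh,
        ← Complex.ofReal_mul, Complex.ofReal_re]
      ring
    rw [ere, hxy2, hXY, ← hs₁2, ← hs₂2, ← ht₁2, ← ht₂2]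
    have hne : 1 - ‖xh‖ ^ 2 ≠ 0 := by linarith
    have hK₁' : K₁ * (1 - ‖xh‖ ^ 2) = (1 - p') * (1 - ‖xh‖ ^ 2 * ‖yh‖ ^ 2) := by
      rw [hK₁, div_mul_cancel₀ _ hne, hXY]
    rw [hD, hK₂]
    linear_combination (2 * (t₁ * t₂) ^ 2 * (s₁ * s₂) ^ 2) * hK₁'
  · -- the LMI: rescale `lmi_unit`
    intro ψ₁ ψ₂
    have h := hU (fun m => (s₂ : ℂ) * ψ₁ m) (fun m => (s₁ : ℂ) * ψ₂ m)
    set W₁ : μ → ℂ := fun c => ∑ m, conj (v₁ (m, c)) * ψ₁ m with hW₁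
    set W₂ : μ → ℂ := fun c => ∑ m, conj (v₂ (m, c)) * ψ₂ m with hW₂
    have eW1 : ∀ c, (∑ m, conj (w₁ (m, c)) * ((s₂ : ℂ) * ψ₁ m)) = ((t₁⁻¹ * s₂ : ℝ) : ℂ) * W₁ c := by
      intro c; simp only [hw₁, hW₁, map_mul, map_inv₀, Complex.conj_ofReal, Finset.mul_sum]; push_cast
      exact Finset.sum_congr rfl fun m _ => by ring
    have eW2 : ∀ c, (∑ m, conj (w₂ (m, c)) * ((s₁ : ℂ) * ψ₂ m)) = ((t₂⁻¹ * s₁ : ℝ) : ℂ) * W₂ c := by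
      intro c; simp only [hw₂, hW₂, map_mul, map_inv₀, Complex.conj_ofReal, Finset.mul_sum]; push_cast
      exact Finset.sum_congr rfl fun m _ => by ring
    have nsc : ∀ (a : ℝ) (f : μ → ℂ), (∑ c, ‖((a : ℝ) : ℂ) * f c‖ ^ 2) = a ^ 2 * ∑ c, ‖f c‖ ^ 2 := by
      intro a f; rw [Finset.mul_sum]; exact Finset.sum_congr rfl fun c _ => by
        rw [norm_mul, Complex.norm_real, Real.norm_eq_abs, mul_pow, sq_abs]
    have nsc' : ∀ (a : ℝ) (f : κ → ℂ), (∑ m, ‖((a : ℝ) : ℂ) * f m‖ ^ 2) = a ^ 2 * ∑ m, ‖f m‖ ^ 2 := by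
      intro a f; rw [Finset.mul_sum]; exact Finset.sum_congr rfl fun m _ => by
        rw [norm_mul, Complex.norm_real, Real.norm_eq_abs, mul_pow, sq_abs]
    have ecr : (∑ c, conj (((t₂⁻¹ * s₁ : ℝ) : ℂ) * W₂ c) * (((t₁⁻¹ * s₂ : ℝ) : ℂ) * W₁ c))
        = (((t₂⁻¹ * s₁) * (t₁⁻¹ * s₂) : ℝ) : ℂ) * ∑ c, conj (W₂ c) * W₁ c := by
      push_cast; rw [Finset.mul_sum]; exact Finset.sum_congr rfl fun c _ => by
        simp only [map_mul, Complex.conj_ofReal, map_inv₀]; ring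
    have eq : (∑ m, conj ((s₁ : ℂ) * ψ₂ m) * ((s₂ : ℂ) * ψ₁ m)) = ((s₁ * s₂ : ℝ) : ℂ) * ∑ m, conj (ψ₂ m) * ψ₁ m := by
      push_cast; rw [Finset.mul_sum]; exact Finset.sum_congr rfl fun m _ => by
        rw [map_mul, Complex.conj_ofReal]; ring
    simp only [eW1, eW2] at h
    rw [nsc, nsc, ecr, nsc', nsc', eq] at h
    -- real parts
    set A : ℝ := ∑ c, ‖W₁ c‖ ^ 2 with hAdef
    set B : ℝ := ∑ c, ‖W₂ c‖ ^ 2 with hBdef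
    set n1 : ℝ := ∑ m, ‖ψ₁ m‖ ^ 2 with hn1
    set n2 : ℝ := ∑ m, ‖ψ₂ m‖ ^ 2 with hn2
    set cr : ℝ := (conj (x * y) * ∑ c, conj (W₂ c) * W₁ c).re with hcr
    set qr : ℝ := (conj x * ∑ m, conj (ψ₂ m) * ψ₁ m).re with hqr
    have e1 : (conj (xh * ((((t₁ * t₂ : ℝ) : ℂ))⁻¹ * y))
        * ((((t₂⁻¹ * s₁) * (t₁⁻¹ * s₂) : ℝ) : ℂ) * ∑ c, conj (W₂ c) * W₁ c)).re
        = ((s₁ * s₂)⁻¹ * (t₁ * t₂)⁻¹ * ((t₂⁻¹ * s₁) * (t₁⁻¹ * s₂))) * cr := by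
      rw [hcr, ← Complex.re_ofReal_mul]
      congr 1
      simp only [hxh, map_mul, map_inv₀, Complex.conj_ofReal]
      push_cast
      field_simp
    have e2 : (-(conj xh * (K₂ : ℂ)) * (((s₁ * s₂ : ℝ) : ℂ) * ∑ m, conj (ψ₂ m) * ψ₁ m)).re = -(K₂ * qr) := by
      rw [hqr, hxh, map_mul, map_inv₀, Complex.conj_ofReal]
      have : -(((↑(s₁ * s₂) : ℂ))⁻¹ * conj x * (K₂ : ℂ)) * (((s₁ * s₂ : ℝ) : ℂ) * ∑ m, conj (ψ₂ m) * ψ₁ m)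
          = ((-K₂ : ℝ) : ℂ) * (conj x * ∑ m, conj (ψ₂ m) * ψ₁ m) := by
        field_simp
        push_cast
        ring
      rw [this, Complex.re_ofReal_mul]; ring
    rw [e1, e2] at h
    -- the goal's pieces
    have g2 : ((((t₁ * t₂) ^ 2 * (s₁ * s₂) : ℝ) : ℂ) * (-(conj xh * (K₂ : ℂ))) * ∑ m, conj (ψ₂ m) * ψ₁ m).re
        = -((t₁ * t₂) ^ 2 * K₂ * qr) := by
      rw [hqr, hxh, map_mul, map_inv₀, Complex.conj_ofReal]
      have : (((t₁ * t₂) ^ 2 * (s₁ * s₂) : ℝ) : ℂ) * (-(((↑(s₁ * s₂) : ℂ))⁻¹ * conj x * (K₂ : ℂ)))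
            * ∑ m, conj (ψ₂ m) * ψ₁ m
          = ((-((t₁ * t₂) ^ 2 * K₂) : ℝ) : ℂ) * (conj x * ∑ m, conj (ψ₂ m) * ψ₁ m) := by
        field_simp
        push_cast
        ring
      rw [this, Complex.re_ofReal_mul]; ring
    rw [g2]
    change nu₂ * nv₂ * A + nu₁ * nv₁ * B - 2 * cr
      ≤ (t₁ * t₂) ^ 2 * s₂ ^ 2 * D * n1 + (t₁ * t₂) ^ 2 * s₁ ^ 2 * D * n2 + 2 * -((t₁ * t₂) ^ 2 * K₂ * qr)
    rw [← hs₁2, ← hs₂2, ← ht₁2, ← ht₂2]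
    have hT : 0 ≤ (t₁ * t₂) ^ 2 := by positivity
    have h' := mul_le_mul_of_nonneg_left h hT
    have i1 : (t₁ * t₂) ^ 2 * ((t₁⁻¹ * s₂) ^ 2 * A) = s₂ ^ 2 * t₂ ^ 2 * A := by field_simp
    have i2 : (t₁ * t₂) ^ 2 * ((t₂⁻¹ * s₁) ^ 2 * B) = s₁ ^ 2 * t₁ ^ 2 * B := by field_simp
    have i3 : (t₁ * t₂) ^ 2 * ((s₁ * s₂)⁻¹ * (t₁ * t₂)⁻¹ * (t₂⁻¹ * s₁ * (t₁⁻¹ * s₂)) * cr) = cr := by field_simp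
    have L : (t₁ * t₂) ^ 2 * ((t₁⁻¹ * s₂) ^ 2 * A + (t₂⁻¹ * s₁) ^ 2 * B
        - 2 * ((s₁ * s₂)⁻¹ * (t₁ * t₂)⁻¹ * (t₂⁻¹ * s₁ * (t₁⁻¹ * s₂)) * cr))
        = s₂ ^ 2 * t₂ ^ 2 * A + s₁ ^ 2 * t₁ ^ 2 * B - 2 * cr := by
      linear_combination i1 + i2 - 2 * i3
    have R : (t₁ * t₂) ^ 2 * (D * (s₂ ^ 2 * n1 + s₁ ^ 2 * n2) + 2 * -(K₂ * qr))
        = (t₁ * t₂) ^ 2 * s₂ ^ 2 * D * n1 + (t₁ * t₂) ^ 2 * s₁ ^ 2 * D * n2 + 2 * -((t₁ * t₂) ^ 2 * K₂ * qr) := by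
      ring
    rw [L, R] at h'
    linarith [h']


/-- **CORE** (the four-matrix inequality), assembled from the zero, collinear and strict cases. -/
theorem core_ineq {ι κ μ : Type*} [Fintype ι] [Fintype κ] [Fintype μ]
    (u₁ u₂ : ι × κ → ℂ) (v₁ v₂ : κ × μ → ℂ) (A B : ι × μ → ℂ)
    (hA : ∀ a, A a = ∑ m, u₁ (a.1, m) * v₁ (m, a.2))
    (hB : ∀ a, B a = ∑ m, u₂ (a.1, m) * v₂ (m, a.2)) :
    ((∑ b, ‖u₁ b‖ ^ 2) * ∑ c, ‖v₁ c‖ ^ 2) * (∑ a, ‖B a‖ ^ 2)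
      + ((∑ b, ‖u₂ b‖ ^ 2) * ∑ c, ‖v₂ c‖ ^ 2) * (∑ a, ‖A a‖ ^ 2)
      + 2 * ‖(∑ b, conj (u₁ b) * u₂ b) * ∑ c, conj (v₁ c) * v₂ c‖ ^ 2
    ≤ 2 * ((∑ b, ‖u₁ b‖ ^ 2) * ∑ c, ‖v₁ c‖ ^ 2) * ((∑ b, ‖u₂ b‖ ^ 2) * ∑ c, ‖v₂ c‖ ^ 2)
      + 2 * (conj ((∑ b, conj (u₁ b) * u₂ b) * ∑ c, conj (v₁ c) * v₂ c)
              * ∑ a, conj (A a) * B a).re := by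
  -- zero cases
  by_cases hu : (∑ b, ‖u₁ b‖ ^ 2) = 0
  · have h0 : ∀ b, u₁ b = 0 := fun b => by
      have := (Finset.sum_eq_zero_iff_of_nonneg fun b _ => by positivity).1 hu b (Finset.mem_univ b)
      exact norm_eq_zero.1 ((pow_eq_zero_iff two_ne_zero).1 this)
    exact core_zero_u₁ u₁ u₂ v₁ v₂ A B hA h0
  by_cases hv : (∑ c, ‖v₁ c‖ ^ 2) = 0
  · have h0 : ∀ c, v₁ c = 0 := fun c => by
      have := (Finset.sum_eq_zero_iff_of_nonneg fun c _ => by positivity).1 hv c (Finset.mem_univ c)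
      exact norm_eq_zero.1 ((pow_eq_zero_iff two_ne_zero).1 this)
    exact core_zero_v₁ u₁ u₂ v₁ v₂ A B hA h0
  have hu' : 0 < ∑ b, ‖u₁ b‖ ^ 2 := lt_of_le_of_ne (Finset.sum_nonneg fun _ _ => by positivity) (Ne.symm hu)
  have hv' : 0 < ∑ c, ‖v₁ c‖ ^ 2 := lt_of_le_of_ne (Finset.sum_nonneg fun _ _ => by positivity) (Ne.symm hv)
  -- Cauchy–Schwarz, strict or not
  rcases (norm_sq_hsum_le u₁ u₂).lt_or_eq with hx | hx
  · rcases (norm_sq_hsum_le v₁ v₂).lt_or_eq with hy | hy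
    · obtain ⟨z₁₁, z₂₂, z₂₁, htr, hLMI⟩ := lmi_exists u₁ u₂ v₁ v₂ hx hy
      exact core_of_certificate u₁ u₂ v₁ v₂ A B hA hB z₁₁ z₂₂ z₂₁ hLMI htr
    · exact core_collinear_v u₁ u₂ v₁ v₂ A B hA hB _ (collinear_of_normsq_eq v₁ v₂ hy hv') hu'
  · exact core_collinear_u u₁ u₂ v₁ v₂ A B hA hB _ (collinear_of_normsq_eq u₁ u₂ hx hu') hv'

/-- **`RankTwoAdditivity` holds** (`M(n,2) = 2`): for every `n` and every bilinear-map tensor `S` on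
`(Fin n × Fin n)³` of tensor rank ≤ 2, `|⟨S, ⟨n,n,n⟩⟩|² ≤ 2 ‖S‖²`. -/
theorem rankTwoAdditivity_proof :
    Summit.MatrixMultiplication.MatrixMultiplication.Theses.FidelityWitnesses.RankTwoAdditivity :=
  rankTwoAdditivity_of_core (fun u₁ u₂ v₁ v₂ A B hA hB => core_ineq u₁ u₂ v₁ v₂ A B hA hB)

end Summit.MatrixMultiplication.MatrixMultiplication.Theorems.RankTwoAdditivity
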